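import Mathlib
import Summits.ValiantsHypothesis.ValiantsHypothesis.Theses.NewtonUnitEquations

/-!
# `DissociatedFixedK` (stmt-ValiantsHypothesis-5907) — CANDIDATE full proof (crux-plan seat, line
`annihilator-product-functional`)

Sorry-free candidate proof of the crux
`Summit.ValiantsHypothesis.ValiantsHypothesis.Theses.NewtonUnitEquations.DissociatedFixedK`
(route NewtonUnitEquations, rank 4), with `C(k) = 2k + 3`, assembled from:

* the line's lever and its fit (`productFunctional_rankOne`, `exists_annihilator`,
  `thickness_of_annihilator`, `thickness_fit` — this seat / ideator 3, checked in
  `Cruxes/DissociatedFixedK/Lines/annihilator-product-functional.lean`);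
* the standing disprover's PROVER KIT (`Cruxes/DissociatedFixedK/Disproof.lean` v3 §E0–§E4, copied
  verbatim: strict exposure of extreme points of a finite set; coefficient/support formula on a
  dissociated frame; sign-vector sweep count; comparison-pattern count `≤ 4|P|²+7`; lexicographic tops and
  their invariance) — closing the skeleton's two stubs as `exposedWord` and `topTupleCount`;
* the skeleton's assembly (alive pattern / alive box / lex tops / slot-list encoding / finset cover /
  arithmetic).

Intended landing spot (prover-only lane): `Summits/ValiantsHypothesis/ValiantsHypothesis/Theorems/…`, citing
`theorem … : …Theses.NewtonUnitEquations.DissociatedFixedK`.  Attached to the item as candidate evidence.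
[folklore; KPTT arXiv:1308.2286 §2 for the setting]
-/

set_option linter.unusedVariables false
set_option linter.dupNamespace false

namespace Summit.ValiantsHypothesis.ValiantsHypothesis.Cruxes.DissociatedFixedK.AnnihilatorProductFunctionalFull

open scoped BigOperators Classical
open Finset

noncomputable section

/-! ## §0  The lever, PROVED (ideator 3, `SketchIdeator3.lean`; re-checked here) -/

/-- The product functional `Λ_λ(h) = Σ_y (Π_j λ_j(y_j)) h(y)` on functions of the Boolean cube factors
on a rank-one function: `Λ_λ(⊗ ψ_j) = Π_j (λ_j(0)ψ_j(0) + λ_j(1)ψ_j(1))`. -/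
theorem productFunctional_rankOne {J : Type*} [Fintype J] [DecidableEq J]
    (lam ψ : J → Bool → ℂ) :
    ∑ y : J → Bool, (∏ j, lam j (y j)) * ∏ j, ψ j (y j)
      = ∏ j, (lam j false * ψ j false + lam j true * ψ j true) := by
  have h := Finset.prod_univ_sum (fun _ : J => (Finset.univ : Finset Bool))
    (fun j b => lam j b * ψ j b)
  simp only [Fintype.piFinset_univ] at h
  have h' : ∀ j : J, (∑ b : Bool, lam j b * ψ j b)
      = lam j false * ψ j false + lam j true * ψ j true := by
    intro j
    rw [Fintype.sum_bool]
    ring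
  simp only [h'] at h
  rw [h]
  refine Finset.sum_congr rfl fun y _ => ?_
  rw [← Finset.prod_mul_distrib]

/-- Existence of the annihilating product functional: `λ_j = (0,1)` on one dead coordinate per dead
live term, `λ_{ι i} = (φ_i(1), -φ_i(0))` along an injection `ι` of the alive terms into the other
coordinates (it exists because `k ≤ |J|`). -/
theorem exists_annihilator {k : ℕ} {J : Type*} [Fintype J] [DecidableEq J]
    (x : Fin k → ℂ) (φ : Fin k → J → Bool → ℂ)
    (hstruct : ∀ i, x i = 0 ∨ (∀ j, φ i j false ≠ 0) ∨ (∃ j, φ i j true = 0))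
    (hk : k ≤ Fintype.card J) :
    ∃ lam : J → Bool → ℂ, (∀ j, lam j true ≠ 0) ∧
      ∀ i, x i = 0 ∨ ∃ j, lam j false * φ i j false + lam j true * φ i j true = 0 := by
  classical
  rcases isEmpty_or_nonempty J with hJ | hJ
  · refine ⟨fun _ _ => 1, fun j => one_ne_zero, fun i => ?_⟩
    have : Fintype.card J = 0 := Fintype.card_eq_zero
    exact absurd i.2 (by omega)
  -- dead terms and a dead coordinate for each
  let dead : Finset (Fin k) := Finset.univ.filter fun i => x i ≠ 0 ∧ ∃ j, φ i j true = 0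
  have hdead : ∀ i ∈ dead, ∃ j, φ i j true = 0 := fun i hi => (Finset.mem_filter.1 hi).2.2
  choose! jd hjd using hdead
  let D : Finset J := dead.image jd
  let alive : Finset (Fin k) := Finset.univ.filter fun i => x i ≠ 0 ∧ ∀ j, φ i j true ≠ 0
  have halive_false : ∀ i ∈ alive, ∀ j, φ i j false ≠ 0 := by
    intro i hi j
    have hi' := (Finset.mem_filter.1 hi).2
    rcases hstruct i with h0 | hf | ⟨j', hj'⟩
    · exact absurd h0 hi'.1
    · exact hf j
    · exact absurd hj' (hi'.2 j')
  have hdisj : Disjoint alive dead := by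
    rw [Finset.disjoint_left]
    intro i h1 h2
    obtain ⟨j, hj⟩ := (Finset.mem_filter.1 h2).2.2
    exact (Finset.mem_filter.1 h1).2.2 j hj
  have hcard1 : alive.card + dead.card ≤ k := by
    rw [← Finset.card_union_of_disjoint hdisj]
    exact (Finset.card_le_univ _).trans (by simp)
  have hD : D.card ≤ dead.card := Finset.card_image_le
  have hDJ : D.card ≤ Fintype.card J := (Finset.card_le_univ D)
  have hcard2 : alive.card ≤ Fintype.card J - D.card := by omega
  -- an embedding of the alive terms into the non-dead coordinates
  have hemb : Nonempty (alive ↪ (Finset.univ \ D : Finset J)) := by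
    apply Function.Embedding.nonempty_of_card_le
    rw [Fintype.card_coe, Fintype.card_coe, Finset.card_sdiff_of_subset (Finset.subset_univ D),
      Finset.card_univ]
    exact hcard2
  obtain ⟨e⟩ := hemb
  have key : ∀ (a : alive)
      (h : ∃ a' : alive, ((e a' : (Finset.univ \ D : Finset J)) : J)
        = ((e a : (Finset.univ \ D : Finset J)) : J)),
      h.choose = a := by
    intro a h
    exact e.injective (Subtype.ext h.choose_spec)
  have heD : ∀ a : alive, ((e a : (Finset.univ \ D : Finset J)) : J) ∉ D :=
    fun a => (Finset.mem_sdiff.1 (e a).2).2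
  -- the functional's factors, with their three evaluation rules
  obtain ⟨lam, hlamD, hlamA, hlamO⟩ : ∃ lam : J → Bool → ℂ,
      (∀ j ∈ D, lam j = fun b => cond b 1 0) ∧
      (∀ a : alive, lam ((e a : (Finset.univ \ D : Finset J)) : J)
        = fun b => cond b (-(φ (a : Fin k) ((e a : (Finset.univ \ D : Finset J)) : J) false))
            (φ (a : Fin k) ((e a : (Finset.univ \ D : Finset J)) : J) true)) ∧
      (∀ j ∉ D, (¬ ∃ a : alive, ((e a : (Finset.univ \ D : Finset J)) : J) = j) →
        lam j = fun b => cond b 1 0) := by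
    refine ⟨fun j => if hj : j ∈ D then (fun b => cond b 1 0)
      else if h : ∃ a : alive, ((e a : (Finset.univ \ D : Finset J)) : J) = j then
        (fun b => cond b (-(φ (h.choose : Fin k) j false)) (φ (h.choose : Fin k) j true))
      else (fun b => cond b 1 0), ?_, ?_, ?_⟩
    · intro j hj
      simp only [dif_pos hj]
    · intro a
      have h : ∃ a' : alive, ((e a' : (Finset.univ \ D : Finset J)) : J)
          = ((e a : (Finset.univ \ D : Finset J)) : J) := ⟨a, rfl⟩
      simp only [dif_neg (heD a), dif_pos h]
      rw [key a h]
    · intro j hj hne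
      simp only [dif_neg hj, dif_neg hne]
  refine ⟨lam, ?_, ?_⟩
  · intro j
    by_cases hjD : j ∈ D
    · rw [hlamD j hjD]; exact one_ne_zero
    · by_cases h : ∃ a : alive, ((e a : (Finset.univ \ D : Finset J)) : J) = j
      · obtain ⟨a, rfl⟩ := h
        rw [hlamA a]
        exact neg_ne_zero.2 (halive_false _ a.2 _)
      · rw [hlamO j hjD h]; exact one_ne_zero
  · intro i
    by_cases hx : x i = 0
    · exact Or.inl hx
    right
    by_cases hdi : ∃ j, φ i j true = 0
    · -- dead term: its chosen coordinate lies in D and λ = (0,1) there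
      have hi : i ∈ dead := Finset.mem_filter.2 ⟨Finset.mem_univ _, hx, hdi⟩
      refine ⟨jd i, ?_⟩
      have hjD : jd i ∈ D := Finset.mem_image_of_mem jd hi
      rw [hlamD _ hjD, hjd i hi]
      simp
    · -- alive term: use the coordinate e ⟨i, _⟩
      push Not at hdi
      have hi : i ∈ alive := Finset.mem_filter.2 ⟨Finset.mem_univ _, hx, hdi⟩
      refine ⟨((e ⟨i, hi⟩ : (Finset.univ \ D : Finset J)) : J), ?_⟩
      rw [hlamA ⟨i, hi⟩]
      simp only [cond_true, cond_false]
      ring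

/-- **Dual-witness thickness on the two-letter sub-cube** (the lever; PROVED).  `x i` = value of term
`i` outside the deviation coordinates `J`; `φ i j true` = coefficient at the survivor's letter `a j`,
`φ i j false` = coefficient at the box letter `b j`.  Structure hypothesis: every term is negligible
(`x i = 0`), alive at the `false` corner, or dead at the `true` corner in some coordinate.  All cube
points other than the all-`true` corner are cancelled, the corner itself survives ⇒ `|J| < k`. -/
theorem thickness_of_annihilator {k : ℕ} {J : Type*} [Fintype J] [DecidableEq J]
    (x : Fin k → ℂ) (φ : Fin k → J → Bool → ℂ)
    (hstruct : ∀ i, x i = 0 ∨ (∀ j, φ i j false ≠ 0) ∨ (∃ j, φ i j true = 0))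
    (hzero : ∀ y : J → Bool, y ≠ (fun _ => true) → ∑ i, x i * ∏ j, φ i j (y j) = 0)
    (htop : ∑ i, x i * ∏ j, φ i j true ≠ 0) :
    Fintype.card J < k := by
  classical
  by_contra hk
  push Not at hk
  obtain ⟨lam, hlam1, hlam2⟩ := exists_annihilator x φ hstruct hk
  -- the functional applied to g, computed two ways
  let g : (J → Bool) → ℂ := fun y => ∑ i, x i * ∏ j, φ i j (y j)
  have way1 : ∑ y : J → Bool, (∏ j, lam j (y j)) * g y = (∏ j, lam j true) * g (fun _ => true) := by
    rw [Finset.sum_eq_single (fun _ => true)]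
    · intro y _ hy
      rw [show g y = 0 from hzero y hy, mul_zero]
    · intro h; exact absurd (Finset.mem_univ _) h
  have way2 : ∑ y : J → Bool, (∏ j, lam j (y j)) * g y
      = ∑ i, x i * ∏ j, (lam j false * φ i j false + lam j true * φ i j true) := by
    have : ∀ y : J → Bool, (∏ j, lam j (y j)) * g y
        = ∑ i, x i * ((∏ j, lam j (y j)) * ∏ j, φ i j (y j)) := by
      intro y
      simp only [g, Finset.mul_sum]
      refine Finset.sum_congr rfl fun i _ => ?_
      ring
    simp only [this]
    rw [Finset.sum_comm]
    refine Finset.sum_congr rfl fun i _ => ?_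
    rw [← Finset.mul_sum, productFunctional_rankOne]
  have hvan : ∑ i, x i * ∏ j, (lam j false * φ i j false + lam j true * φ i j true) = 0 := by
    refine Finset.sum_eq_zero fun i _ => ?_
    rcases hlam2 i with h0 | ⟨j, hj⟩
    · rw [h0, zero_mul]
    · rw [Finset.prod_eq_zero (Finset.mem_univ j) hj, mul_zero]
  have hprod : (∏ j, lam j true) ≠ 0 := Finset.prod_ne_zero_iff.2 fun j _ => hlam1 j
  have : (∏ j, lam j true) * g (fun _ => true) = 0 := by rw [← way1, way2, hvan]
  rcases mul_eq_zero.1 this with h | h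
  · exact hprod h
  · exact htop h


/-! ## §1  Thickness at a vertex — the lever fitted to the crux's data (PROVED, no sorry) -/

/-- **thickness_fit** — blueprint step 3 by the annihilating product functional (THIS LINE'S LEVER,
now machine-checked end to end).  `c i j e` is an abstract coefficient tensor (for the crux:
`coeff e (f i j)`), `a` the strict `l`-top surviving word, `b` a word of the frame that is letterwise
`l`-above `a` (`hba`) and alive in every coordinate for every product alive at `a` (`hbI`).  Then `b` and
`a` differ in `< k` places.  Proof: on the sub-cube `Π_{j ∈ J} {a j, b j} × Π_{j ∉ J} {a j}`,
`J = {j : b j ≠ a j}`, every word other than `a` is `l`-≥ `a` (additivity of `l ∘ emb` over letters,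
`hba`) and `≠ a`, hence has `T = 0` by `htop`; with `x i = Π_{j∉J} c i j (a j)`,
`φ i j true = c i j (a j)`, `φ i j false = c i j (b j)` the trichotomy of `thickness_of_annihilator`
holds (`hbI` for alive terms; a term dead at `a` is dead inside `J` or has `x i = 0`), and that theorem
gives `card J < k`.  No dissociation and no genericity of `l` are needed.
[same statement shape as the landed `Negative.CubeLemma.mixed_cube_lemma`, p73482] -/
theorem thickness_fit {k m : ℕ} (A : Fin m → Finset (Fin 2 →₀ ℕ))
    (c : Fin k → Fin m → (Fin 2 →₀ ℕ) → ℂ) (l : (Fin 2 → ℝ) →L[ℝ] ℝ)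
    (a b : Fin m → (Fin 2 →₀ ℕ)) (ha : ∀ j, a j ∈ A j) (hb : ∀ j, b j ∈ A j)
    (hTa : (∑ i, ∏ j, c i j (a j)) ≠ 0)
    (htop : ∀ a' : Fin m → (Fin 2 →₀ ℕ), (∀ j, a' j ∈ A j) → a' ≠ a →
      (∑ i, ∏ j, c i j (a' j)) ≠ 0 →
      l (fun i : Fin 2 => (((∑ j, a' j) i : ℕ) : ℝ)) < l (fun i : Fin 2 => (((∑ j, a j) i : ℕ) : ℝ)))
    (hbI : ∀ i, (∀ j, c i j (a j) ≠ 0) → ∀ j, c i j (b j) ≠ 0)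
    (hba : ∀ j, l (fun i : Fin 2 => (((a j) i : ℕ) : ℝ)) ≤ l (fun i : Fin 2 => (((b j) i : ℕ) : ℝ))) :
    (Finset.univ.filter fun j => b j ≠ a j).card < k := by
  classical
  set J : Finset (Fin m) := Finset.univ.filter fun j => b j ≠ a j with hJ
  -- sub-cube data: value outside `J`, two letters inside `J` (`true ↦ a j`, `false ↦ b j`)
  let x : Fin k → ℂ := fun i => ∏ j ∈ Jᶜ, c i j (a j)
  let φ : Fin k → ↥J → Bool → ℂ := fun i j y => c i j (cond y (a j) (b j))
  -- the grid word of a cube corner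
  let wd : (↥J → Bool) → Fin m → (Fin 2 →₀ ℕ) := fun y j =>
    if h : j ∈ J then cond (y ⟨j, h⟩) (a j) (b j) else a j
  have hwdA : ∀ y j, wd y j ∈ A j := by
    intro y j
    simp only [wd]
    split_ifs with h
    · rcases Bool.eq_false_or_eq_true (y ⟨j, h⟩) with hy | hy
      · rw [hy]; exact ha j
      · rw [hy]; exact hb j
    · exact ha j
  -- tensor value at a corner = the cube expression
  have hT : ∀ y, (∑ i, ∏ j, c i j (wd y j)) = ∑ i, x i * ∏ j : ↥J, φ i j (y j) := by
    intro y
    refine Finset.sum_congr rfl fun i _ => ?_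
    rw [← Finset.prod_mul_prod_compl J (fun j => c i j (wd y j)), mul_comm]
    congr 1
    · show ∏ j ∈ Jᶜ, c i j (wd y j) = ∏ j ∈ Jᶜ, c i j (a j)
      refine Finset.prod_congr rfl fun j hj => ?_
      have hj' : j ∉ J := Finset.mem_compl.1 hj
      simp only [wd, dif_neg hj']
    · show ∏ j ∈ J, c i j (wd y j) = ∏ j : ↥J, φ i j (y j)
      rw [← Finset.prod_coe_sort J]
      refine Finset.prod_congr rfl fun j _ => ?_
      simp only [wd, φ, dif_pos j.2, Subtype.coe_eta]
  -- `l ∘ emb` is additive over the letters of a word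
  have e1 : ∀ w : Fin m → (Fin 2 →₀ ℕ),
      l (fun i : Fin 2 => (((∑ j, w j) i : ℕ) : ℝ)) = ∑ j, l (fun i : Fin 2 => (((w j) i : ℕ) : ℝ)) := by
    intro w
    have e0 : (fun i : Fin 2 => (((∑ j, w j) i : ℕ) : ℝ))
        = ∑ j, (fun i : Fin 2 => (((w j) i : ℕ) : ℝ)) := by
      funext i
      simp only [Finsupp.coe_finsetSum, Finset.sum_apply, Nat.cast_sum]
    rw [e0, map_sum]
  -- every corner other than the all-`true` corner is cancelled
  have hzero : ∀ y : ↥J → Bool, y ≠ (fun _ => true) → ∑ i, x i * ∏ j : ↥J, φ i j (y j) = 0 := by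
    intro y hy
    rw [← hT y]
    by_contra hne
    -- the corner word differs from `a`
    have hwa : wd y ≠ a := by
      intro heq
      obtain ⟨j, hj⟩ := Function.ne_iff.1 hy
      have hyj : y j = false := by simpa using hj
      have h1 := congrFun heq j
      simp only [wd, dif_pos j.2, Subtype.coe_eta, hyj, cond_false] at h1
      exact (Finset.mem_filter.1 j.2).2 h1
    -- but it is `l`-at-least `a`
    have hge : l (fun i : Fin 2 => (((∑ j, a j) i : ℕ) : ℝ))
        ≤ l (fun i : Fin 2 => (((∑ j, wd y j) i : ℕ) : ℝ)) := by
      rw [e1 a, e1 (wd y)]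
      refine Finset.sum_le_sum fun j _ => ?_
      by_cases hj : j ∈ J
      · simp only [wd, dif_pos hj]
        rcases Bool.eq_false_or_eq_true (y ⟨j, hj⟩) with hy' | hy'
        · rw [hy']; exact le_rfl
        · rw [hy']; exact hba j
      · simp only [wd, dif_neg hj]
        exact le_rfl
    exact absurd (htop (wd y) (hwdA y) hwa hne) (not_lt.2 hge)
  -- the all-`true` corner is `a` itself and survives
  have hwtrue : wd (fun _ => true) = a := by
    funext j
    by_cases hj : j ∈ J
    · simp only [wd, dif_pos hj, cond_true]
    · simp only [wd, dif_neg hj]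
  have htop' : ∑ i, x i * ∏ j : ↥J, φ i j true ≠ 0 := by
    have h := (hT (fun _ => true)).symm
    simp only [hwtrue] at h
    rw [h]
    exact hTa
  -- trichotomy: negligible / alive at the `false` corner / dead at the `true` corner
  have hstruct : ∀ i, x i = 0 ∨ (∀ j : ↥J, φ i j false ≠ 0) ∨ (∃ j : ↥J, φ i j true = 0) := by
    intro i
    by_cases hal : ∀ j, c i j (a j) ≠ 0
    · exact Or.inr (Or.inl fun j => hbI i hal j)
    · push Not at hal
      obtain ⟨j₀, hj₀⟩ := hal
      by_cases hjJ : j₀ ∈ J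
      · exact Or.inr (Or.inr ⟨⟨j₀, hjJ⟩, hj₀⟩)
      · exact Or.inl (Finset.prod_eq_zero (Finset.mem_compl.2 hjJ) hj₀)
  have hlt := thickness_of_annihilator x φ hstruct hzero htop'
  rwa [Fintype.card_coe] at hlt


/-! ## §K  The disprover's prover kit (Disproof.lean v3 §E0–§E4), copied verbatim -/

/-- The embedding `ℕ²`-exponents ↦ `ℝ²` used by the route (literal subterm of the crux). -/
noncomputable def emb (e : Fin 2 →₀ ℕ) : Fin 2 → ℝ := fun i => ((e i : ℕ) : ℝ)

theorem emb_injective : Function.Injective emb := by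
  intro e e' h
  ext i
  have := congrFun h i
  simpa [emb] using this

/-! ## §E0  Blueprint step 2: extreme points of a finite planar set are strictly exposed -/

/-- **Blueprint step 2 (exposure), prover-facing.**  An extreme point of the convex hull of a FINITE
set in a normed space (used: `Fin 2 → ℝ`) is strictly exposed by a continuous linear functional:
`l y < l x` for every other point `y` of the set.  (Hahn–Banach against the compact convex hull of the
other points.) [folklore] -/
theorem exists_strict_sep_of_mem_extremePoints_convexHull {E : Type*} [NormedAddCommGroup E]
    [NormedSpace ℝ E] {S : Set E} (hS : S.Finite) {x : E}
    (hx : x ∈ Set.extremePoints ℝ (convexHull ℝ S)) :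
    ∃ l : E →L[ℝ] ℝ, ∀ y ∈ S, y ≠ x → l y < l x := by
  have hxS : x ∈ S := extremePoints_convexHull_subset hx
  set S' : Set E := S \ {x} with hS'
  have hS'fin : S'.Finite := hS.subset Set.sdiff_subset
  have hK : IsCompact (convexHull ℝ S') := Set.Finite.isCompact_convexHull (𝕜 := ℝ) hS'fin
  have hxK : x ∉ convexHull ℝ S' := by
    intro hmem
    have h := ((convex_convexHull ℝ S).mem_extremePoints_iff_mem_sdiff_convexHull_sdiff).mp hx
    apply h.2
    refine convexHull_mono ?_ hmem
    intro y hy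
    exact ⟨subset_convexHull ℝ S hy.1, hy.2⟩
  obtain ⟨f, u, hfx, hfb⟩ :=
    geometric_hahn_banach_point_closed (convex_convexHull ℝ S') hK.isClosed hxK
  refine ⟨-f, ?_⟩
  intro y hy hne
  have : u < f y := hfb y (subset_convexHull ℝ S' ⟨hy, hne⟩)
  show -f y < -f x
  linarith


/-! ## §E1  Blueprint step 1: in the dissociated regime the coefficient IS the rank-`k` tensor -/

section Coeff

open MvPolynomial

variable {R : Type*} [CommSemiring R] {σ : Type*}

/-- A polynomial whose support lies in `A` is the sum of its terms over `A`. -/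
theorem eq_sum_monomial_of_support_subset (p : MvPolynomial σ R) (A : Finset (σ →₀ ℕ))
    (h : p.support ⊆ A) : p = ∑ e ∈ A, monomial e (coeff e p) := by
  conv_lhs => rw [p.as_sum]
  apply Finset.sum_subset h
  intro e _ he
  rw [notMem_support_iff.mp he, monomial_zero]

/-- Expansion of a product of polynomials with supports in the letter sets `A j`:
`Π_j f_j = Σ_{g ∈ Π_j A_j} (Π_j coeff (g j) f_j) · X^{Σ_j g j}`. -/
theorem prod_eq_sum_piFinset {m : ℕ} (A : Fin m → Finset (σ →₀ ℕ)) (f : Fin m → MvPolynomial σ R)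
    (hsupp : ∀ j, (f j).support ⊆ A j) :
    (∏ j, f j) = ∑ g ∈ Fintype.piFinset A, monomial (∑ j, g j) (∏ j, coeff (g j) (f j)) := by
  have : (∏ j, f j) = ∏ j, ∑ e ∈ A j, monomial e (coeff e (f j)) :=
    Finset.prod_congr rfl (fun j _ => eq_sum_monomial_of_support_subset (f j) (A j) (hsupp j))
  rw [this, Finset.prod_univ_sum]
  apply Finset.sum_congr rfl
  intro g _
  rw [monomial_sum_prod]

/-- **Coefficient formula (blueprint step 1).**  With `supp f_ij ⊆ A_j` and the sum map injective on
`Π_j A_j`, the coefficient of `X^{Σ_j a_j}` in `Σ_i Π_j f_ij` is the tensor value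
`T(a) = Σ_i Π_j coeff (a j) (f i j)`. -/
theorem coeff_sum_prod_of_dissociated {k m : ℕ} (A : Fin m → Finset (σ →₀ ℕ))
    (f : Fin k → Fin m → MvPolynomial σ R) (hsupp : ∀ i j, (f i j).support ⊆ A j)
    (hinj : ∀ a b : Fin m → (σ →₀ ℕ), (∀ j, a j ∈ A j) → (∀ j, b j ∈ A j) →
      ∑ j, a j = ∑ j, b j → a = b)
    (a : Fin m → (σ →₀ ℕ)) (ha : ∀ j, a j ∈ A j) :
    coeff (∑ j, a j) (∑ i, ∏ j, f i j) = ∑ i, ∏ j, coeff (a j) (f i j) := by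
  classical
  rw [coeff_sum]
  apply Finset.sum_congr rfl
  intro i _
  rw [prod_eq_sum_piFinset A (f i) (hsupp i), coeff_sum]
  have hamem : a ∈ Fintype.piFinset A := Fintype.mem_piFinset.mpr ha
  rw [Finset.sum_eq_single_of_mem a hamem]
  · simp
  · intro g hg hga
    rw [coeff_monomial, if_neg]
    intro hsum
    exact hga (hinj g a (Fintype.mem_piFinset.mp hg) ha hsum)

/-- **Support formula (blueprint step 1).**  Every exponent in the support of `Σ_i Π_j f_ij` is
`Σ_j a_j` for a grid word `a ∈ Π_j A_j` with `T(a) ≠ 0`. -/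
theorem exists_word_of_mem_support {k m : ℕ} (A : Fin m → Finset (σ →₀ ℕ))
    (f : Fin k → Fin m → MvPolynomial σ R) (hsupp : ∀ i j, (f i j).support ⊆ A j)
    (hinj : ∀ a b : Fin m → (σ →₀ ℕ), (∀ j, a j ∈ A j) → (∀ j, b j ∈ A j) →
      ∑ j, a j = ∑ j, b j → a = b)
    {e : σ →₀ ℕ} (he : e ∈ (∑ i, ∏ j, f i j).support) :
    ∃ a : Fin m → (σ →₀ ℕ), (∀ j, a j ∈ A j) ∧ ∑ j, a j = e ∧
      ∑ i, ∏ j, coeff (a j) (f i j) ≠ 0 := by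
  classical
  -- the support of the sum of products lies in the image of the grid
  have hsub : (∑ i, ∏ j, f i j).support ⊆
      (Fintype.piFinset A).image (fun g => ∑ j, g j) := by
    refine (MvPolynomial.support_sum).trans ?_
    intro e' he'
    simp only [Finset.mem_biUnion, Finset.mem_univ, true_and] at he'
    obtain ⟨i, hi⟩ := he'
    rw [prod_eq_sum_piFinset A (f i) (hsupp i)] at hi
    have := MvPolynomial.support_sum hi
    simp only [Finset.mem_biUnion] at this
    obtain ⟨g, hg, hge⟩ := this
    have := support_monomial_subset hge
    simp only [Finset.mem_singleton] at this
    exact Finset.mem_image.mpr ⟨g, hg, this.symm⟩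
  obtain ⟨a, ha, rfl⟩ := Finset.mem_image.mp (hsub he)
  refine ⟨a, Fintype.mem_piFinset.mp ha, rfl, ?_⟩
  rw [← coeff_sum_prod_of_dissociated A f hsupp hinj a (Fintype.mem_piFinset.mp ha)]
  exact mem_support_iff.mp he

end Coeff

/-! ## §E2  Blueprint step 4 (counting): sign patterns along a one-parameter sweep -/

section Sweep

/-- The sign vector of the affine functions `λ ↦ d.1 + λ·d.2`, `d ∈ D`, at the parameter `λ`. -/
noncomputable def signVec (D : Finset (ℝ × ℝ)) (t : ℝ) : ↥D → SignType :=
  fun d => SignType.sign (d.1.1 + t * d.1.2)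

/-- The roots of the non-constant affine functions. -/
noncomputable def sweepRoots (D : Finset (ℝ × ℝ)) : Finset ℝ :=
  (D.filter (fun d => d.2 ≠ 0)).image (fun d => -d.1 / d.2)

theorem card_sweepRoots_le (D : Finset (ℝ × ℝ)) : (sweepRoots D).card ≤ D.card :=
  Finset.card_image_le.trans (Finset.card_filter_le _ _)

/-- The combinatorial position of `λ` relative to the roots: (number of roots below, is a root). -/
noncomputable def sweepKey (D : Finset (ℝ × ℝ)) (t : ℝ) : ℕ × Bool :=
  (((sweepRoots D).filter (fun r => r < t)).card, decide (t ∈ sweepRoots D))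

theorem sweepKey_mem (D : Finset (ℝ × ℝ)) (t : ℝ) :
    sweepKey D t ∈ (Finset.range ((sweepRoots D).card + 1) ×ˢ (Finset.univ : Finset Bool)) := by
  simp only [sweepKey, Finset.mem_product, Finset.mem_range, Finset.mem_univ, and_true]
  exact Nat.lt_succ_of_le (Finset.card_filter_le _ _)

/-- Core of the sweep: between (and off) the roots the sign vector is constant.  Version `t < t'`. -/
theorem signVec_eq_of_sweepKey_eq_of_lt (D : Finset (ℝ × ℝ)) {t t' : ℝ} (htt' : t < t')
    (hkey : sweepKey D t = sweepKey D t') : signVec D t = signVec D t' := by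
  have hsub : (sweepRoots D).filter (fun r => r < t) ⊆ (sweepRoots D).filter (fun r => r < t') := by
    intro r hr
    simp only [Finset.mem_filter] at hr ⊢
    exact ⟨hr.1, hr.2.trans htt'⟩
  have hcard : ((sweepRoots D).filter (fun r => r < t)).card =
      ((sweepRoots D).filter (fun r => r < t')).card := congrArg Prod.fst hkey
  -- no root in `[t, t')`
  have hnoroot : ∀ r ∈ sweepRoots D, ¬ (t ≤ r ∧ r < t') := by
    rintro r hr ⟨h1, h2⟩
    have hss : (sweepRoots D).filter (fun r => r < t) ⊂ (sweepRoots D).filter (fun r => r < t') := by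
      refine Finset.ssubset_iff_of_subset hsub |>.mpr ⟨r, ?_, ?_⟩
      · simp [hr, h2]
      · simp [not_lt.mpr h1]
    exact absurd hcard (Finset.card_lt_card hss).ne
  have ht : t ∉ sweepRoots D := fun h => hnoroot t h ⟨le_rfl, htt'⟩
  have ht' : t' ∉ sweepRoots D := by
    have := congrArg Prod.snd hkey
    simp only [sweepKey, decide_eq_decide] at this
    exact fun h => ht (this.mpr h)
  funext d
  simp only [signVec]
  by_cases hd2 : d.1.2 = 0
  · simp [hd2]
  · set r : ℝ := -d.1.1 / d.1.2 with hr
    have hrmem : r ∈ sweepRoots D :=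
      Finset.mem_image.mpr ⟨d.1, Finset.mem_filter.mpr ⟨d.2, hd2⟩, rfl⟩
    have hfac : ∀ s : ℝ, d.1.1 + s * d.1.2 = d.1.2 * (s - r) := by
      intro s; rw [hr]; field_simp; ring
    rw [hfac t, hfac t', sign_mul, sign_mul]
    congr 1
    have htr : t ≠ r := fun h => ht (h ▸ hrmem)
    have ht'r : t' ≠ r := fun h => ht' (h ▸ hrmem)
    rcases lt_or_gt_of_ne htr with h | h
    · -- t < r : then also t' < r (no root in [t, t'))
      have h' : t' < r := by
        rcases lt_or_gt_of_ne ht'r with h' | h'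
        · exact h'
        · exact absurd ⟨h.le, h'⟩ (hnoroot r hrmem)
      rw [sign_neg (sub_neg.mpr h), sign_neg (sub_neg.mpr h')]
    · have h' : r < t' := h.trans htt'
      rw [sign_pos (sub_pos.mpr h), sign_pos (sub_pos.mpr h')]

theorem signVec_eq_of_sweepKey_eq (D : Finset (ℝ × ℝ)) {t t' : ℝ}
    (hkey : sweepKey D t = sweepKey D t') : signVec D t = signVec D t' := by
  rcases lt_trichotomy t t' with h | rfl | h
  · exact signVec_eq_of_sweepKey_eq_of_lt D h hkey
  · rfl
  · exact (signVec_eq_of_sweepKey_eq_of_lt D h hkey.symm).symm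

/-- **Sweep count.** The sign vectors of `|D|` affine functions of one real parameter take at most
`2|D| + 2` values. [folklore] -/
theorem ncard_range_signVec_le (D : Finset (ℝ × ℝ)) :
    (Set.range (signVec D)).ncard ≤ 2 * D.card + 2 := by
  classical
  -- choose a parameter for each realised sign vector and map it to its key
  have hchoose : ∀ s ∈ Set.range (signVec D), ∃ t, signVec D t = s := fun s hs => hs
  choose par hpar using hchoose
  set T : Finset (ℕ × Bool) :=
    Finset.range ((sweepRoots D).card + 1) ×ˢ (Finset.univ : Finset Bool) with hT
  have hmaps : ∀ s (hs : s ∈ Set.range (signVec D)), sweepKey D (par s hs) ∈ (T : Set (ℕ × Bool)) :=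
    fun s hs => by exact_mod_cast sweepKey_mem D (par s hs)
  -- injectivity of s ↦ key (par s) on the range
  let φ : (↥D → SignType) → ℕ × Bool := fun s =>
    if hs : s ∈ Set.range (signVec D) then sweepKey D (par s hs) else (0, false)
  have hφmaps : ∀ s ∈ Set.range (signVec D), φ s ∈ (T : Set (ℕ × Bool)) := by
    intro s hs; simp only [φ, dif_pos hs]; exact hmaps s hs
  have hφinj : Set.InjOn φ (Set.range (signVec D)) := by
    intro s hs s' hs' h
    simp only [φ, dif_pos hs, dif_pos hs'] at h
    rw [← hpar s hs, ← hpar s' hs']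
    exact signVec_eq_of_sweepKey_eq D h
  have h1 : (Set.range (signVec D)).ncard ≤ (T : Set (ℕ × Bool)).ncard :=
    Set.ncard_le_ncard_of_injOn φ hφmaps hφinj (Finset.finite_toSet T)
  rw [Set.ncard_coe_finset] at h1
  have h2 : T.card = ((sweepRoots D).card + 1) * 2 := by
    simp [hT, Finset.card_product]
  have h3 := card_sweepRoots_le D
  calc (Set.range (signVec D)).ncard ≤ T.card := h1
    _ = ((sweepRoots D).card + 1) * 2 := h2
    _ ≤ 2 * D.card + 2 := by omega

end Sweep


/-! ## §E3  Comparison patterns of linear functionals on a finite planar point set -/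

section CmpPat

/-- The comparison pattern a continuous linear functional induces on a finite point set. -/
noncomputable def cmpPat (P : Finset (Fin 2 → ℝ)) (l : (Fin 2 → ℝ) →L[ℝ] ℝ) : ↥P × ↥P → Bool :=
  fun pq => decide (l pq.1 < l pq.2)

/-- The difference vectors of `P`, as pairs of reals. -/
noncomputable def diffSet (P : Finset (Fin 2 → ℝ)) : Finset (ℝ × ℝ) :=
  (P ×ˢ P).image (fun pq => (pq.2 0 - pq.1 0, pq.2 1 - pq.1 1))

theorem card_diffSet_le (P : Finset (Fin 2 → ℝ)) : (diffSet P).card ≤ P.card * P.card :=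
  Finset.card_image_le.trans (by rw [Finset.card_product])

theorem diff_mem_diffSet (P : Finset (Fin 2 → ℝ)) (pq : ↥P × ↥P) :
    ((pq.2 : Fin 2 → ℝ) 0 - (pq.1 : Fin 2 → ℝ) 0, (pq.2 : Fin 2 → ℝ) 1 - (pq.1 : Fin 2 → ℝ) 1)
      ∈ diffSet P :=
  Finset.mem_image.mpr ⟨((pq.1 : Fin 2 → ℝ), (pq.2 : Fin 2 → ℝ)),
    Finset.mem_product.mpr ⟨pq.1.2, pq.2.2⟩, rfl⟩

/-- A linear functional on `ℝ²` in coordinates. -/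
theorem clm_apply_fin_two (l : (Fin 2 → ℝ) →L[ℝ] ℝ) (v : Fin 2 → ℝ) :
    l v = l (Pi.single 0 1) * v 0 + l (Pi.single 1 1) * v 1 := by
  have hv : v = v 0 • (Pi.single 0 1 : Fin 2 → ℝ) + v 1 • (Pi.single 1 1 : Fin 2 → ℝ) := by
    funext i
    fin_cases i <;> simp
  conv_lhs => rw [hv]
  simp only [map_add, map_smul, smul_eq_mul]
  ring

/-- **Pattern count.** As `l` ranges over ALL continuous linear functionals on `ℝ²`, the comparison
pattern on a finite set `P` takes at most `4|P|² + 7` values (sweep `l = (±1, λ)`, `(0, ±1)`, `0`).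
[folklore] -/
theorem ncard_range_cmpPat_le (P : Finset (Fin 2 → ℝ)) :
    (Set.range (cmpPat P)).ncard ≤ 4 * (P.card * P.card) + 7 := by
  classical
  set D := diffSet P with hD
  -- decoders
  let dv : ↥P × ↥P → ↥D := fun pq => ⟨_, diff_mem_diffSet P pq⟩
  let Fp : (↥D → SignType) → (↥P × ↥P → Bool) := fun s pq => decide (s (dv pq) = 1)
  let Fm : (↥D → SignType) → (↥P × ↥P → Bool) := fun s pq => decide (s (dv pq) = -1)
  let G : SignType → (↥P × ↥P → Bool) := fun σ pq =>
    decide (σ * SignType.sign ((pq.2 : Fin 2 → ℝ) 1 - (pq.1 : Fin 2 → ℝ) 1) = 1)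
  have hcover : Set.range (cmpPat P) ⊆
      (Fp '' Set.range (signVec D) ∪ Fm '' Set.range (signVec D)) ∪ G '' Set.univ := by
    rintro _ ⟨l, rfl⟩
    set l₁ := l (Pi.single 0 1) with hl₁
    set l₂ := l (Pi.single 1 1) with hl₂
    have hdiff : ∀ pq : ↥P × ↥P, l pq.2 - l pq.1 =
        l₁ * ((pq.2 : Fin 2 → ℝ) 0 - (pq.1 : Fin 2 → ℝ) 0) +
          l₂ * ((pq.2 : Fin 2 → ℝ) 1 - (pq.1 : Fin 2 → ℝ) 1) := by
      intro pq
      rw [clm_apply_fin_two l (pq.2 : Fin 2 → ℝ), clm_apply_fin_two l (pq.1 : Fin 2 → ℝ)]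
      ring
    rcases lt_trichotomy 0 l₁ with h1 | h1 | h1
    · -- l₁ > 0
      left; left
      refine ⟨signVec D (l₂ / l₁), ⟨l₂ / l₁, rfl⟩, ?_⟩
      funext pq
      simp only [Fp, cmpPat, signVec, dv]
      have key : (0 : ℝ) < ((pq.2 : Fin 2 → ℝ) 0 - (pq.1 : Fin 2 → ℝ) 0) +
          l₂ / l₁ * ((pq.2 : Fin 2 → ℝ) 1 - (pq.1 : Fin 2 → ℝ) 1) ↔ l pq.1 < l pq.2 := by
        rw [← sub_pos (a := l pq.2), hdiff pq]
        constructor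
        · intro h
          have := mul_pos h1 h
          calc (0 : ℝ) < l₁ * ((pq.2 : Fin 2 → ℝ) 0 - (pq.1 : Fin 2 → ℝ) 0 +
              l₂ / l₁ * ((pq.2 : Fin 2 → ℝ) 1 - (pq.1 : Fin 2 → ℝ) 1)) := this
            _ = _ := by field_simp
        · intro h
          have := div_pos h h1
          calc (0 : ℝ) < (l₁ * ((pq.2 : Fin 2 → ℝ) 0 - (pq.1 : Fin 2 → ℝ) 0) +
              l₂ * ((pq.2 : Fin 2 → ℝ) 1 - (pq.1 : Fin 2 → ℝ) 1)) / l₁ := this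
            _ = _ := by field_simp
      by_cases hc : l pq.1 < l pq.2
      · have hpos := key.mpr hc
        simp [hc, sign_pos hpos]
      · have hnpos : ¬ (0 : ℝ) < _ := fun h => hc (key.mp h)
        rcases eq_or_lt_of_le (not_lt.mp hnpos) with h0 | hneg
        · simp [hc, h0]
        · simp [hc, sign_neg hneg]
    · -- l₁ = 0
      right
      refine ⟨SignType.sign l₂, Set.mem_univ _, ?_⟩
      funext pq
      simp only [G, cmpPat]
      have key : l pq.1 < l pq.2 ↔ 0 < l₂ * ((pq.2 : Fin 2 → ℝ) 1 - (pq.1 : Fin 2 → ℝ) 1) := by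
        rw [← sub_pos (a := l pq.2), hdiff pq, ← h1]; simp
      rw [← sign_mul]
      by_cases hc : l pq.1 < l pq.2
      · simp [hc, sign_pos (key.mp hc)]
      · have hnpos : ¬ (0 : ℝ) < _ := fun h => hc (key.mpr h)
        rcases eq_or_lt_of_le (not_lt.mp hnpos) with h0 | hneg
        · simp [hc, h0]
        · simp [hc, sign_neg hneg]
    · -- l₁ < 0
      left; right
      refine ⟨signVec D (l₂ / l₁), ⟨l₂ / l₁, rfl⟩, ?_⟩
      funext pq
      simp only [Fm, cmpPat, signVec, dv]
      have hne : l₁ ≠ 0 := h1.ne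
      have key : ((pq.2 : Fin 2 → ℝ) 0 - (pq.1 : Fin 2 → ℝ) 0) +
          l₂ / l₁ * ((pq.2 : Fin 2 → ℝ) 1 - (pq.1 : Fin 2 → ℝ) 1) < 0 ↔ l pq.1 < l pq.2 := by
        rw [← sub_pos (a := l pq.2), hdiff pq]
        constructor
        · intro h
          have := mul_pos_of_neg_of_neg h1 h
          calc (0 : ℝ) < l₁ * ((pq.2 : Fin 2 → ℝ) 0 - (pq.1 : Fin 2 → ℝ) 0 +
              l₂ / l₁ * ((pq.2 : Fin 2 → ℝ) 1 - (pq.1 : Fin 2 → ℝ) 1)) := this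
            _ = _ := by field_simp
        · intro h
          have := div_neg_of_pos_of_neg h h1
          calc ((pq.2 : Fin 2 → ℝ) 0 - (pq.1 : Fin 2 → ℝ) 0) +
              l₂ / l₁ * ((pq.2 : Fin 2 → ℝ) 1 - (pq.1 : Fin 2 → ℝ) 1)
              = (l₁ * ((pq.2 : Fin 2 → ℝ) 0 - (pq.1 : Fin 2 → ℝ) 0) +
                l₂ * ((pq.2 : Fin 2 → ℝ) 1 - (pq.1 : Fin 2 → ℝ) 1)) / l₁ := by
                field_simp
            _ < 0 := this
      by_cases hc : l pq.1 < l pq.2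
      · have hneg := key.mpr hc
        simp [hc, sign_neg hneg]
      · have hnneg : ¬ _ < (0 : ℝ) := fun h => hc (key.mp h)
        rcases eq_or_lt_of_le (not_lt.mp hnneg) with h0 | hpos
        · simp [hc, ← h0]
        · simp [hc, sign_pos hpos]
  have hSVfin : (Set.range (signVec D)).Finite := Set.toFinite _
  have hSV := ncard_range_signVec_le D
  have hDcard : D.card ≤ P.card * P.card := card_diffSet_le P
  have hG : (G '' Set.univ).ncard ≤ 3 := by
    calc (G '' Set.univ).ncard ≤ (Set.univ : Set SignType).ncard :=
          Set.ncard_image_le (Set.toFinite _)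
      _ = 3 := by rw [Set.ncard_univ, Nat.card_eq_fintype_card]; rfl
  calc (Set.range (cmpPat P)).ncard
      ≤ ((Fp '' Set.range (signVec D) ∪ Fm '' Set.range (signVec D)) ∪ G '' Set.univ).ncard :=
        Set.ncard_le_ncard hcover (Set.toFinite _)
    _ ≤ (Fp '' Set.range (signVec D) ∪ Fm '' Set.range (signVec D)).ncard + (G '' Set.univ).ncard :=
        Set.ncard_union_le _ _
    _ ≤ ((Fp '' Set.range (signVec D)).ncard + (Fm '' Set.range (signVec D)).ncard) +
          (G '' Set.univ).ncard := by gcongr; exact Set.ncard_union_le _ _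
    _ ≤ ((Set.range (signVec D)).ncard + (Set.range (signVec D)).ncard) + 3 := by
        gcongr
        · exact Set.ncard_image_le hSVfin
        · exact Set.ncard_image_le hSVfin
    _ ≤ 4 * (P.card * P.card) + 7 := by omega

end CmpPat


/-! ## §E4  The lexicographic top of a letter set and its invariance under equal comparison patterns -/

section LexTop

/-- Sort key of an exponent under the functional `l`: its `l`-value, ties broken by the exponent itself
(lexicographically on its two coordinates).  Values in the linear order `ℝ ×ₗ (ℕ ×ₗ ℕ)`. -/
noncomputable def lexKey (l : (Fin 2 → ℝ) →L[ℝ] ℝ) (q : Fin 2 →₀ ℕ) : Lex (ℝ × Lex (ℕ × ℕ)) :=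
  toLex (l (emb q), toLex (q 0, q 1))

theorem lexKey_injective (l : (Fin 2 → ℝ) →L[ℝ] ℝ) : Function.Injective (lexKey l) := by
  intro q q' h
  have h2 : (toLex (q 0, q 1) : Lex (ℕ × ℕ)) = toLex (q' 0, q' 1) := congrArg Prod.snd (toLex.injective h)
  have h3 : (q 0, q 1) = (q' 0, q' 1) := toLex.injective h2
  ext i
  fin_cases i
  · exact congrArg Prod.fst h3
  · exact congrArg Prod.snd h3

/-- The `l`-top letter of a nonempty letter set `C` (ties broken by `lexKey`). -/
noncomputable def lexTop (l : (Fin 2 → ℝ) →L[ℝ] ℝ) (C : Finset (Fin 2 →₀ ℕ)) (hC : C.Nonempty) :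
    Fin 2 →₀ ℕ :=
  (Finset.exists_max_image C (lexKey l) hC).choose

theorem lexTop_mem (l : (Fin 2 → ℝ) →L[ℝ] ℝ) (C : Finset (Fin 2 →₀ ℕ)) (hC : C.Nonempty) :
    lexTop l C hC ∈ C :=
  (Finset.exists_max_image C (lexKey l) hC).choose_spec.1

theorem lexKey_le_lexTop (l : (Fin 2 → ℝ) →L[ℝ] ℝ) (C : Finset (Fin 2 →₀ ℕ)) (hC : C.Nonempty)
    {q : Fin 2 →₀ ℕ} (hq : q ∈ C) : lexKey l q ≤ lexKey l (lexTop l C hC) :=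
  (Finset.exists_max_image C (lexKey l) hC).choose_spec.2 q hq

/-- Uniqueness: any `lexKey`-maximal letter of `C` is the top. -/
theorem eq_lexTop_of_forall_le (l : (Fin 2 → ℝ) →L[ℝ] ℝ) (C : Finset (Fin 2 →₀ ℕ)) (hC : C.Nonempty)
    {q : Fin 2 →₀ ℕ} (hq : q ∈ C) (hmax : ∀ q' ∈ C, lexKey l q' ≤ lexKey l q) :
    q = lexTop l C hC :=
  lexKey_injective l (le_antisymm (lexKey_le_lexTop l C hC hq) (hmax _ (lexTop_mem l C hC)))

/-- **Invariance.** Two functionals that compare the letters of `C` identically have the same top. -/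
theorem lexTop_eq_of_cmp_iff (l l' : (Fin 2 → ℝ) →L[ℝ] ℝ) (C : Finset (Fin 2 →₀ ℕ)) (hC : C.Nonempty)
    (H : ∀ p ∈ C, ∀ q ∈ C, (l (emb p) < l (emb q) ↔ l' (emb p) < l' (emb q))) :
    lexTop l C hC = lexTop l' C hC := by
  apply eq_lexTop_of_forall_le l' C hC (lexTop_mem l C hC)
  intro q hq
  have h := lexKey_le_lexTop l C hC hq
  simp only [lexKey, Prod.Lex.le_iff] at h ⊢
  rcases h with h | ⟨h1, h2⟩
  · exact Or.inl ((H q hq _ (lexTop_mem l C hC)).mp h)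
  · right
    refine ⟨?_, h2⟩
    have h1' : l (emb q) = l (emb (lexTop l C hC)) := h1
    have a : ¬ l' (emb q) < l' (emb (lexTop l C hC)) := fun h' => by
      have := (H q hq _ (lexTop_mem l C hC)).mpr h'
      rw [h1'] at this
      exact lt_irrefl _ this
    have b : ¬ l' (emb (lexTop l C hC)) < l' (emb q) := fun h' => by
      have := (H _ (lexTop_mem l C hC) q hq).mpr h'
      rw [h1'] at this
      exact lt_irrefl _ this
    exact le_antisymm (not_lt.mp b) (not_lt.mp a)

/-- The same, from equality of comparison patterns on any finite `P ⊇ emb '' C` (so, with §E3: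
for fixed `C` — and for a fixed tuple of letter sets — the top (tuple) takes `≤ 4|P|² + 7` values as `l`
ranges over all functionals). -/
theorem lexTop_eq_of_cmpPat_eq (P : Finset (Fin 2 → ℝ)) (l l' : (Fin 2 → ℝ) →L[ℝ] ℝ)
    (hpat : cmpPat P l = cmpPat P l') (C : Finset (Fin 2 →₀ ℕ)) (hC : C.Nonempty)
    (hCP : ∀ q ∈ C, emb q ∈ P) : lexTop l C hC = lexTop l' C hC := by
  apply lexTop_eq_of_cmp_iff
  intro p hp q hq
  have := congrFun hpat (⟨emb p, hCP p hp⟩, ⟨emb q, hCP q hq⟩)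
  simpa [cmpPat] using this

/-- Counting form used in blueprint step 4: for a tuple of nonempty letter sets inside `P`, the tuple of
tops, as a function of the functional, factors through `cmpPat P`; hence its range has
`≤ 4|P|² + 7` elements. -/
theorem ncard_range_topTuple_le {m : ℕ} (P : Finset (Fin 2 → ℝ)) (C : Fin m → Finset (Fin 2 →₀ ℕ))
    (hC : ∀ j, (C j).Nonempty) (hCP : ∀ j, ∀ q ∈ C j, emb q ∈ P) :
    (Set.range (fun l : (Fin 2 → ℝ) →L[ℝ] ℝ => fun j => lexTop l (C j) (hC j))).ncard
      ≤ 4 * (P.card * P.card) + 7 := by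
  classical
  set tt := (fun l : (Fin 2 → ℝ) →L[ℝ] ℝ => fun j => lexTop l (C j) (hC j)) with htt
  -- tt factors through cmpPat P
  have hfac : ∀ l l', cmpPat P l = cmpPat P l' → tt l = tt l' := by
    intro l l' h
    funext j
    exact lexTop_eq_of_cmpPat_eq P l l' h (C j) (hC j) (hCP j)
  -- so range tt is the image of range (cmpPat P) under a function
  have hchoose : ∀ c ∈ Set.range (cmpPat P), ∃ l, cmpPat P l = c := fun c hc => hc
  choose fn hfn using hchoose
  let Φ : (↥P × ↥P → Bool) → (Fin m → (Fin 2 →₀ ℕ)) := fun c =>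
    if hc : c ∈ Set.range (cmpPat P) then tt (fn c hc) else fun j => lexTop 0 (C j) (hC j)
  have hsub : Set.range tt ⊆ Φ '' Set.range (cmpPat P) := by
    rintro _ ⟨l, rfl⟩
    refine ⟨cmpPat P l, ⟨l, rfl⟩, ?_⟩
    have hc : cmpPat P l ∈ Set.range (cmpPat P) := ⟨l, rfl⟩
    simp only [Φ, dif_pos hc]
    exact hfac _ _ (hfn _ hc)
  calc (Set.range tt).ncard ≤ (Φ '' Set.range (cmpPat P)).ncard :=
        Set.ncard_le_ncard hsub (Set.toFinite _)
    _ ≤ (Set.range (cmpPat P)).ncard := Set.ncard_image_le (Set.toFinite _)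
    _ ≤ 4 * (P.card * P.card) + 7 := ncard_range_cmpPat_le P

end LexTop


/-! ## §S  The skeleton's two stubs, closed with the kit -/

/-- `stub_exposedWord` of the skeleton, PROVED: blueprint steps 1–2 (dictionary + strict exposure). -/
theorem exposedWord {k m : ℕ} (A : Fin m → Finset (Fin 2 →₀ ℕ))
    (f : Fin k → Fin m → MvPolynomial (Fin 2) ℂ)
    (hf : ∀ i j, (f i j).support ⊆ A j)
    (hinj : ∀ a b : Fin m → (Fin 2 →₀ ℕ), (∀ j, a j ∈ A j) → (∀ j, b j ∈ A j) →
      ∑ j, a j = ∑ j, b j → a = b)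
    (p : Fin 2 → ℝ)
    (hp : p ∈ Set.extremePoints ℝ (convexHull ℝ
      ((fun e : Fin 2 →₀ ℕ => fun i : Fin 2 => ((e i : ℕ) : ℝ)) ''
        ((∑ i, ∏ j, f i j).support : Set (Fin 2 →₀ ℕ))))) :
    ∃ (a : Fin m → (Fin 2 →₀ ℕ)) (l : (Fin 2 → ℝ) →L[ℝ] ℝ),
      (∀ j, a j ∈ A j) ∧
      p = (fun i : Fin 2 => (((∑ j, a j) i : ℕ) : ℝ)) ∧
      (∑ i, ∏ j, (f i j).coeff (a j)) ≠ 0 ∧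
      ∀ a' : Fin m → (Fin 2 →₀ ℕ), (∀ j, a' j ∈ A j) → a' ≠ a →
        (∑ i, ∏ j, (f i j).coeff (a' j)) ≠ 0 →
        l (fun i : Fin 2 => (((∑ j, a' j) i : ℕ) : ℝ)) < l (fun i : Fin 2 => (((∑ j, a j) i : ℕ) : ℝ)) := by
  classical
  have hpS : p ∈ (fun e : Fin 2 →₀ ℕ => fun i : Fin 2 => ((e i : ℕ) : ℝ)) ''
      ((∑ i, ∏ j, f i j).support : Set (Fin 2 →₀ ℕ)) :=
    extremePoints_convexHull_subset hp
  obtain ⟨e, he, rfl⟩ := hpS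
  obtain ⟨a, ha, hae, hTa⟩ := exists_word_of_mem_support A f hf hinj (Finset.mem_coe.1 he)
  have hfin : ((fun e : Fin 2 →₀ ℕ => fun i : Fin 2 => ((e i : ℕ) : ℝ)) ''
      ((∑ i, ∏ j, f i j).support : Set (Fin 2 →₀ ℕ))).Finite :=
    (Finset.finite_toSet _).image _
  obtain ⟨l, hl⟩ := exists_strict_sep_of_mem_extremePoints_convexHull hfin hp
  refine ⟨a, l, ha, ?_, hTa, ?_⟩
  · rw [hae]
  · intro a' ha' hne hTa'
    have hmem : (∑ j, a' j) ∈ (∑ i, ∏ j, f i j).support := by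
      rw [MvPolynomial.mem_support_iff, coeff_sum_prod_of_dissociated A f hf hinj a' ha']
      exact hTa'
    have hneq : (fun i : Fin 2 => (((∑ j, a' j) i : ℕ) : ℝ)) ≠ (fun i : Fin 2 => ((e i : ℕ) : ℝ)) := by
      intro heq
      apply hne
      apply hinj a' a ha' ha
      rw [hae]
      exact emb_injective heq
    have hlt := hl _ ⟨_, Finset.mem_coe.2 hmem, rfl⟩ hneq
    rw [hae]
    exact hlt

/-- `stub_topTupleCount` of the skeleton, PROVED: blueprint step 4 (the box tops are few). -/
theorem topTupleCount (m t : ℕ) (S : Fin m → Finset (Fin 2 →₀ ℕ)) (hS : ∀ j, (S j).card ≤ t) :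
    ((Fintype.piFinset S).filter fun b : Fin m → (Fin 2 →₀ ℕ) =>
        ∃ l : (Fin 2 → ℝ) →L[ℝ] ℝ, ∀ j, ∀ e ∈ S j,
          (toLex (l (fun i : Fin 2 => ((e i : ℕ) : ℝ)), toLex (e 0, e 1)) : Lex (ℝ × Lex (ℕ × ℕ)))
            ≤ toLex (l (fun i : Fin 2 => (((b j) i : ℕ) : ℝ)), toLex ((b j) 0, (b j) 1))).card
      ≤ 4 * (m * t) ^ 2 + 7 := by
  classical
  by_cases hne : ∀ j, (S j).Nonempty
  · set P : Finset (Fin 2 → ℝ) := (Finset.univ.biUnion S).image emb with hP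
    have hPcard : P.card ≤ m * t := by
      calc P.card ≤ (Finset.univ.biUnion S).card := Finset.card_image_le
        _ ≤ ∑ j, (S j).card := Finset.card_biUnion_le
        _ ≤ ∑ _j : Fin m, t := Finset.sum_le_sum fun j _ => hS j
        _ = m * t := by simp
    have hCP : ∀ j, ∀ q ∈ S j, emb q ∈ P := fun j q hq =>
      Finset.mem_image.2 ⟨q, Finset.mem_biUnion.2 ⟨j, Finset.mem_univ _, hq⟩, rfl⟩
    have hsub : (↑((Fintype.piFinset S).filter fun b : Fin m → (Fin 2 →₀ ℕ) =>
        ∃ l : (Fin 2 → ℝ) →L[ℝ] ℝ, ∀ j, ∀ e ∈ S j,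
          (toLex (l (fun i : Fin 2 => ((e i : ℕ) : ℝ)), toLex (e 0, e 1)) : Lex (ℝ × Lex (ℕ × ℕ)))
            ≤ toLex (l (fun i : Fin 2 => (((b j) i : ℕ) : ℝ)), toLex ((b j) 0, (b j) 1))) :
          Set (Fin m → (Fin 2 →₀ ℕ)))
        ⊆ Set.range (fun l : (Fin 2 → ℝ) →L[ℝ] ℝ => fun j => lexTop l (S j) (hne j)) := by
      intro b hb
      rw [Finset.mem_coe, Finset.mem_filter] at hb
      obtain ⟨hbS, l, hl⟩ := hb
      refine ⟨l, ?_⟩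
      funext j
      exact (eq_lexTop_of_forall_le l (S j) (hne j) (Fintype.mem_piFinset.1 hbS j)
        (fun q hq => hl j q hq)).symm
    have hfinR : (Set.range (fun l : (Fin 2 → ℝ) →L[ℝ] ℝ => fun j => lexTop l (S j) (hne j))).Finite := by
      refine (Finset.finite_toSet (Fintype.piFinset S)).subset ?_
      rintro _ ⟨l, rfl⟩
      exact Finset.mem_coe.2 (Fintype.mem_piFinset.2 fun j => lexTop_mem l (S j) (hne j))
    have hsq : P.card * P.card ≤ m * t * (m * t) := Nat.mul_le_mul hPcard hPcard
    calc ((Fintype.piFinset S).filter fun b : Fin m → (Fin 2 →₀ ℕ) =>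
          ∃ l : (Fin 2 → ℝ) →L[ℝ] ℝ, ∀ j, ∀ e ∈ S j,
            (toLex (l (fun i : Fin 2 => ((e i : ℕ) : ℝ)), toLex (e 0, e 1)) : Lex (ℝ × Lex (ℕ × ℕ)))
              ≤ toLex (l (fun i : Fin 2 => (((b j) i : ℕ) : ℝ)), toLex ((b j) 0, (b j) 1))).card
        = (↑((Fintype.piFinset S).filter fun b : Fin m → (Fin 2 →₀ ℕ) =>
          ∃ l : (Fin 2 → ℝ) →L[ℝ] ℝ, ∀ j, ∀ e ∈ S j,
            (toLex (l (fun i : Fin 2 => ((e i : ℕ) : ℝ)), toLex (e 0, e 1)) : Lex (ℝ × Lex (ℕ × ℕ)))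
              ≤ toLex (l (fun i : Fin 2 => (((b j) i : ℕ) : ℝ)), toLex ((b j) 0, (b j) 1))) :
            Set (Fin m → (Fin 2 →₀ ℕ))).ncard := (Set.ncard_coe_finset _).symm
      _ ≤ (Set.range (fun l : (Fin 2 → ℝ) →L[ℝ] ℝ => fun j => lexTop l (S j) (hne j))).ncard :=
          Set.ncard_le_ncard hsub hfinR
      _ ≤ 4 * (P.card * P.card) + 7 := ncard_range_topTuple_le P S hne hCP
      _ ≤ 4 * (m * t) ^ 2 + 7 := by rw [sq]; omega
  · push Not at hne
    obtain ⟨j, hj⟩ := hne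
    have hempty : Fintype.piFinset S = ∅ :=
      Fintype.piFinset_eq_empty.2 ⟨j, hj⟩
    rw [hempty]
    simp

/-! ## §3  Encoding helpers for the assembly (PROVED) -/

/-- Decode: the letter for coordinate `j` is read off the slot list `L` (any slot carrying `j`),
defaulting to `b j` when no slot carries `j`. -/
def word {k m : ℕ} (L : Fin k → Option (Fin m × (Fin 2 →₀ ℕ)))
    (b : Fin m → (Fin 2 →₀ ℕ)) (j : Fin m) : Fin 2 →₀ ℕ :=
  if h : ∃ s : Fin k, ∃ e : Fin 2 →₀ ℕ, L s = some (j, e) then (Classical.choose_spec h).choose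
  else b j

theorem word_eq {k m : ℕ} {L : Fin k → Option (Fin m × (Fin 2 →₀ ℕ))}
    {b a : Fin m → (Fin 2 →₀ ℕ)} {j : Fin m}
    (hfaith : ∀ (s : Fin k) (e : Fin 2 →₀ ℕ), L s = some (j, e) → e = a j)
    (hcov : (∃ s : Fin k, ∃ e : Fin 2 →₀ ℕ, L s = some (j, e)) ∨ b j = a j) :
    word L b j = a j := by
  unfold word
  split_ifs with h
  · exact hfaith _ _ (Classical.choose_spec h).choose_spec
  · rcases hcov with h' | h'
    · exact absurd h' h
    · exact h'

/-- Encode: the canonical slot list of a coordinate set `J` (in increasing order) with the letters of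
`a`, padded with `none`. -/
def canon {k m : ℕ} (J : Finset (Fin m)) (a : Fin m → (Fin 2 →₀ ℕ)) (s : Fin k) :
    Option (Fin m × (Fin 2 →₀ ℕ)) :=
  if h : (s : ℕ) < J.card then
    some (J.orderEmbOfFin rfl ⟨s, h⟩, a (J.orderEmbOfFin rfl ⟨s, h⟩))
  else none

theorem canon_apply_of_eq {k m : ℕ} (J : Finset (Fin m)) (a : Fin m → (Fin 2 →₀ ℕ)) (s : Fin k)
    (r : Fin J.card) (hs : (s : ℕ) = r) :
    canon J a s = some (J.orderEmbOfFin rfl r, a (J.orderEmbOfFin rfl r)) := by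
  have h : (s : ℕ) < J.card := hs ▸ r.2
  unfold canon
  rw [dif_pos h]
  have e1 : (⟨(s : ℕ), h⟩ : Fin J.card) = r := Fin.ext hs
  rw [e1]

theorem canon_faithful {k m : ℕ} {J : Finset (Fin m)} {a : Fin m → (Fin 2 →₀ ℕ)} {s : Fin k}
    {j : Fin m} {e : Fin 2 →₀ ℕ} (hs : canon J a s = some (j, e)) : j ∈ J ∧ e = a j := by
  unfold canon at hs
  by_cases h : (s : ℕ) < J.card
  · rw [dif_pos h] at hs
    simp only [Option.some.injEq, Prod.mk.injEq] at hs
    obtain ⟨hj, he⟩ := hs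
    subst hj
    exact ⟨Finset.orderEmbOfFin_mem _ _ _, he.symm⟩
  · rw [dif_neg h] at hs
    exact absurd hs (by simp)

theorem canon_covers {k m : ℕ} {J : Finset (Fin m)} {a : Fin m → (Fin 2 →₀ ℕ)} {j : Fin m}
    (hj : j ∈ J) (hJ : J.card ≤ k) :
    ∃ s : Fin k, ∃ e : Fin 2 →₀ ℕ, canon J a s = some (j, e) := by
  have hr : j ∈ Set.range (J.orderEmbOfFin rfl) := by
    rw [Finset.range_orderEmbOfFin, Finset.mem_coe]
    exact hj
  obtain ⟨r, hr⟩ := hr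
  refine ⟨⟨r, lt_of_lt_of_le r.2 hJ⟩, a j, ?_⟩
  rw [canon_apply_of_eq J a ⟨r, lt_of_lt_of_le r.2 hJ⟩ r rfl, hr]

theorem canon_mem {k m : ℕ} (A : Fin m → Finset (Fin 2 →₀ ℕ)) {J : Finset (Fin m)}
    {a : Fin m → (Fin 2 →₀ ℕ)} (ha : ∀ j, a j ∈ A j) (s : Fin k) :
    canon J a s ∈ Finset.insertNone (Finset.univ.biUnion fun j => (A j).image (Prod.mk j)) := by
  unfold canon
  by_cases h : (s : ℕ) < J.card
  · rw [dif_pos h, Finset.some_mem_insertNone]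
    refine Finset.mem_biUnion.2 ⟨J.orderEmbOfFin rfl ⟨s, h⟩, Finset.mem_univ _, ?_⟩
    exact Finset.mem_image.2 ⟨_, ha _, rfl⟩
  · rw [dif_neg h]
    exact Finset.none_mem_insertNone

/-- The final arithmetic: `2^k (mt+1)^k (4(mt)²+7) ≤ (mt+2)^(2k+3)`. -/
theorem count_arith (k m t : ℕ) :
    2 ^ k * ((m * t + 1) ^ k * (4 * (m * t) ^ 2 + 7)) ≤ (m * t + 2) ^ (2 * k + 3) := by
  have h2k : 2 ^ k ≤ (m * t + 2) ^ k := Nat.pow_le_pow_left (by omega) k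
  have hmk : (m * t + 1) ^ k ≤ (m * t + 2) ^ k := Nat.pow_le_pow_left (by omega) k
  have hlast : 4 * (m * t) ^ 2 + 7 ≤ (m * t + 2) ^ 3 := by
    have e : (m * t + 2) ^ 3 = (m * t) ^ 3 + 6 * (m * t) ^ 2 + 12 * (m * t) + 8 := by ring
    rw [e]
    have h0 : 0 ≤ (m * t) ^ 3 := Nat.zero_le _
    omega
  calc 2 ^ k * ((m * t + 1) ^ k * (4 * (m * t) ^ 2 + 7))
      ≤ (m * t + 2) ^ k * ((m * t + 2) ^ k * (m * t + 2) ^ 3) :=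
        Nat.mul_le_mul h2k (Nat.mul_le_mul hmk hlast)
    _ = (m * t + 2) ^ (2 * k + 3) := by ring


/-! ## §A  The assembly: the crux BY NAME (sorry-free) -/

/-- **`DissociatedFixedK` holds**, with `C(k) = 2k + 3`: for a vertex `p` take `(a, l)` from
`exposedWord`, the alive pattern `I` of `a`, the alive box `C I j ∋ a j`, `b j` a lex-maximal letter of
`C I j`; `thickness_fit` gives `#{j : b j ≠ a j} < k`; the slot-list encoding `(I, canon J a, b)`
covers the vertex set by a finset of size `≤ 2^k (mt+1)^k (4(mt)²+7) ≤ (mt+2)^(2k+3)`. -/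
theorem dissociatedFixedK :
    Summit.ValiantsHypothesis.ValiantsHypothesis.Theses.NewtonUnitEquations.DissociatedFixedK := by
  intro k
  refine ⟨2 * k + 3, ?_⟩
  intro m t A f hA hf hinj
  -- the coefficient tensor and the alive boxes `C I j`
  set c : Fin k → Fin m → (Fin 2 →₀ ℕ) → ℂ := fun i j e => (f i j).coeff e with hc
  set C : Finset (Fin k) → Fin m → Finset (Fin 2 →₀ ℕ) := fun I j =>
    (A j).filter fun e => ∀ i ∈ I, c i j e ≠ 0 with hC
  have hCA : ∀ I j, C I j ⊆ A j := fun I j => Finset.filter_subset _ _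
  have hCcard : ∀ I j, (C I j).card ≤ t := fun I j => (Finset.card_le_card (hCA I j)).trans (hA j)
  -- the box tops of pattern `I` (over all functionals), counted by `topTupleCount`
  set BT : Finset (Fin k) → Finset (Fin m → (Fin 2 →₀ ℕ)) := fun I =>
    (Fintype.piFinset (C I)).filter fun b : Fin m → (Fin 2 →₀ ℕ) =>
      ∃ l : (Fin 2 → ℝ) →L[ℝ] ℝ, ∀ j, ∀ e ∈ C I j,
        (toLex (l (fun i : Fin 2 => ((e i : ℕ) : ℝ)), toLex (e 0, e 1)) : Lex (ℝ × Lex (ℕ × ℕ)))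
          ≤ toLex (l (fun i : Fin 2 => (((b j) i : ℕ) : ℝ)), toLex ((b j) 0, (b j) 1)) with hBT
  have hBTcard : ∀ I, (BT I).card ≤ 4 * (m * t) ^ 2 + 7 := fun I =>
    topTupleCount m t (C I) (hCcard I)
  -- the letters and the slot lists
  set LET : Finset (Fin m × (Fin 2 →₀ ℕ)) :=
    Finset.univ.biUnion fun j => (A j).image (Prod.mk j) with hLET
  set LST : Finset (Fin k → Option (Fin m × (Fin 2 →₀ ℕ))) :=
    Fintype.piFinset fun _ => Finset.insertNone LET with hLST
  have hLETcard : LET.card ≤ m * t := by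
    calc LET.card ≤ ∑ j, ((A j).image (Prod.mk j)).card := Finset.card_biUnion_le
      _ ≤ ∑ _j : Fin m, t := Finset.sum_le_sum fun j _ => Finset.card_image_le.trans (hA j)
      _ = m * t := by simp
  have hLSTcard : LST.card ≤ (m * t + 1) ^ k := by
    have e : LST.card = (LET.card + 1) ^ k := by
      simp only [hLST, Fintype.card_piFinset, Finset.card_insertNone, Finset.prod_const,
        Finset.card_univ, Fintype.card_fin]
    rw [e]
    exact Nat.pow_le_pow_left (by omega) k
  -- the covering finset
  set U : Finset (Fin 2 → ℝ) := (Finset.univ : Finset (Finset (Fin k))).biUnion fun I =>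
    LST.biUnion fun L => (BT I).image fun b =>
      (fun i : Fin 2 => (((∑ j, word L b j) i : ℕ) : ℝ)) with hU
  have hUcard : U.card ≤ 2 ^ k * ((m * t + 1) ^ k * (4 * (m * t) ^ 2 + 7)) := by
    calc U.card
        ≤ ∑ I : Finset (Fin k), (LST.biUnion fun L => (BT I).image fun b =>
            (fun i : Fin 2 => (((∑ j, word L b j) i : ℕ) : ℝ))).card := Finset.card_biUnion_le
      _ ≤ ∑ I : Finset (Fin k), ∑ L ∈ LST, ((BT I).image fun b =>
            (fun i : Fin 2 => (((∑ j, word L b j) i : ℕ) : ℝ))).card :=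
          Finset.sum_le_sum fun I _ => Finset.card_biUnion_le
      _ ≤ ∑ I : Finset (Fin k), ∑ L ∈ LST, (4 * (m * t) ^ 2 + 7) :=
          Finset.sum_le_sum fun I _ => Finset.sum_le_sum fun L _ =>
            Finset.card_image_le.trans (hBTcard I)
      _ = Fintype.card (Finset (Fin k)) * (LST.card * (4 * (m * t) ^ 2 + 7)) := by
          simp only [Finset.sum_const, smul_eq_mul, Finset.card_univ]
      _ ≤ 2 ^ k * ((m * t + 1) ^ k * (4 * (m * t) ^ 2 + 7)) := by
          rw [Fintype.card_finset, Fintype.card_fin]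
          exact Nat.mul_le_mul_left _ (Nat.mul_le_mul_right _ hLSTcard)
  -- every vertex is covered
  have hcover : Set.extremePoints ℝ (convexHull ℝ
      ((fun e : Fin 2 →₀ ℕ => fun i : Fin 2 => ((e i : ℕ) : ℝ)) ''
        ((∑ i, ∏ j, f i j).support : Set (Fin 2 →₀ ℕ)))) ⊆ ↑U := by
    intro p hp
    obtain ⟨a, l, ha, hpa, hTa, htop⟩ := exposedWord A f hf hinj p hp
    -- alive pattern of `a` and its box
    set I : Finset (Fin k) := Finset.univ.filter fun i => ∀ j, c i j (a j) ≠ 0 with hI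
    have haC : ∀ j, a j ∈ C I j := by
      intro j
      refine Finset.mem_filter.2 ⟨ha j, fun i hi => ?_⟩
      exact (Finset.mem_filter.1 hi).2 j
    -- coordinatewise lexicographic tops of the box
    have hex : ∀ j, ∃ bj ∈ C I j, ∀ e ∈ C I j,
        (toLex (l (fun i : Fin 2 => ((e i : ℕ) : ℝ)), toLex (e 0, e 1)) : Lex (ℝ × Lex (ℕ × ℕ)))
          ≤ toLex (l (fun i : Fin 2 => ((bj i : ℕ) : ℝ)), toLex (bj 0, bj 1)) := fun j =>
      Finset.exists_max_image (C I j)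
        (fun e : Fin 2 →₀ ℕ =>
          (toLex (l (fun i : Fin 2 => ((e i : ℕ) : ℝ)), toLex (e 0, e 1)) : Lex (ℝ × Lex (ℕ × ℕ))))
        ⟨a j, haC j⟩
    choose b hbC hbmax using hex
    have hbA : ∀ j, b j ∈ A j := fun j => hCA I j (hbC j)
    have hba : ∀ j, l (fun i : Fin 2 => (((a j) i : ℕ) : ℝ)) ≤ l (fun i : Fin 2 => (((b j) i : ℕ) : ℝ)) := by
      intro j
      have h := hbmax j (a j) (haC j)
      rw [Prod.Lex.toLex_le_toLex] at h
      rcases h with h | ⟨h, _⟩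
      · exact h.le
      · exact h.le
    have hbI : ∀ i, (∀ j, c i j (a j) ≠ 0) → ∀ j, c i j (b j) ≠ 0 := by
      intro i hi j
      have hiI : i ∈ I := Finset.mem_filter.2 ⟨Finset.mem_univ _, hi⟩
      exact (Finset.mem_filter.1 (hbC j)).2 i hiI
    -- thickness (the lever)
    have hthick : (Finset.univ.filter fun j => b j ≠ a j).card < k :=
      thickness_fit A c l a b ha hbA hTa htop hbI hba
    set J : Finset (Fin m) := Finset.univ.filter fun j => b j ≠ a j with hJ
    -- decoding the canonical slot list of `(J, a)` against `b` returns `a`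
    have hword : ∀ j, word (canon (k := k) J a) b j = a j := by
      intro j
      apply word_eq (a := a)
      · intro s e hs
        exact (canon_faithful hs).2
      · by_cases hj : j ∈ J
        · exact Or.inl (canon_covers hj hthick.le)
        · right
          by_contra hne
          exact hj (Finset.mem_filter.2 ⟨Finset.mem_univ _, hne⟩)
    have hsum : (∑ j, word (canon (k := k) J a) b j) = ∑ j, a j :=
      Finset.sum_congr rfl fun j _ => hword j
    -- membership in the covering finset
    rw [Finset.mem_coe]
    refine Finset.mem_biUnion.2 ⟨I, Finset.mem_univ _, ?_⟩
    refine Finset.mem_biUnion.2 ⟨canon (k := k) J a, ?_, ?_⟩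
    · exact Fintype.mem_piFinset.2 fun s => canon_mem A ha s
    · refine Finset.mem_image.2 ⟨b, ?_, ?_⟩
      · exact Finset.mem_filter.2 ⟨Fintype.mem_piFinset.2 hbC, l, fun j e he => hbmax j e he⟩
      · rw [hpa, hsum]
  -- conclude
  calc (Set.extremePoints ℝ (convexHull ℝ
          ((fun e : Fin 2 →₀ ℕ => fun i : Fin 2 => ((e i : ℕ) : ℝ)) ''
            ((∑ i, ∏ j, f i j).support : Set (Fin 2 →₀ ℕ))))).ncard
      ≤ (↑U : Set (Fin 2 → ℝ)).ncard := Set.ncard_le_ncard hcover U.finite_toSet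
    _ = U.card := Set.ncard_coe_finset U
    _ ≤ 2 ^ k * ((m * t + 1) ^ k * (4 * (m * t) ^ 2 + 7)) := hUcard
    _ ≤ (m * t + 2) ^ (2 * k + 3) := count_arith k m t

end

end Summit.ValiantsHypothesis.ValiantsHypothesis.Cruxes.DissociatedFixedK.AnnihilatorProductFunctionalFull
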